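import Summits.Ventures.YMGap.RobustBall.IsingBallB2Embed
import Summits.Ventures.YMGap.RobustBall.IsingBallB2Bound
import Summits.Ventures.YMGap.RobustBall.IsingSetDecay
import HarnessLib

/-!
# RobustBall/IsingBallB2Layer — the RUNG-3 certificate of the balls `B₂(a)` in the layer graph and the two-point bound
# `⟨σ_b σ_t⟩ ≤ φ₀^{⌊dist_j/3⌋}`, `φ₀ = 0.97868…`, for the layer Ising model at every coupling `0 ≤ β ≤ artanh(4/21)`

HONEST FRAMING: venture file of the cell `pub-ymgap` (QuantumFields programme), track Y2 ROBUST-BALL / DS seat ds-4 (g10).  Finite statements about the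
free-boundary Ising model on the layer graph `layerGraph i H` of the discrete torus `(ℤ/L)^4` (`ZTwoLayerGraph`); no `SU(2)` measure here (that is
`CentreBlindBallWindow`); nothing about the continuum.

WHAT.  With the induced copy `B₂(a) = ballSet` of the explicit ball (`IsingBallB2Embed`): an axis site of the ball has `≤ 5` and a corner `≤ 4`
layer-neighbours outside it, the centre and the middle sites none (`card_exitSet_axis_le`, `card_exitSet_corner_le`, `exitSet_eq_empty_of_inner`; the exit set of `x` is `(univ \ ballSet).filter (Adj x)`);
hence the Simon–Lieb certificate of `B₂(a)` is `≤ tanh β · (5 ∑_axis + 4 ∑_corner) ≤ (4/21) · B₀ = φ₀ = b2Rate = 0.97868…` for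
`0 ≤ β ≤ β₀ = artanh(4/21)` (`ball_certificate_le`, from `IsingBallB2Bound.b2_boundarySum_le`), and the LADDER ENGINE
`IsingStar.isingTwoPoint_free_le_pow_of_certificate` (radius `r = 2`; unselected heights are isolated sites with certificate `0`) gives
**`isingTwoPoint_layer_le_b2Rate_pow`**: `⟨σ_b σ_t⟩^∅_{univ;β} ≤ φ₀^{⌊dist_j(t,b)/3⌋}` on `layerGraph i H`, every `H`, `L ≥ 6`, `0 ≤ β ≤ β₀`.
Rung 2 (`IsingStarDecay`, stars) needed `30 tanh²β < 1`, i.e. `β < 0.18463`; rung 3 holds up to `β₀ = 0.19283`.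

References: B. Simon, Comm. Math. Phys. 77 (1980) 111; E. Lieb, Comm. Math. Phys. 77 (1980) 127; H. Duminil-Copin, V. Tassion, Comm. Math. Phys. 343
(2016) 725, Lemma 2.7.
-/

noncomputable section

open Finset
open Literature.Probability.LatticeModels
open Literature.MathematicalPhysics.QuantumFieldTheory

namespace Summit.Ventures.YMGap.RobustBall

namespace ZTwo

open B2V ZN

variable {L : ℕ} [NeZero L]

/-! ### Layer-neighbours outside the ball -/

/-- The exit set avoids a given set `T` of neighbours INSIDE the ball, so it has `≤ 6 − |T|` elements (degree `≤ 6`). [folklore] -/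
theorem card_exitSet_le (hL : 6 ≤ L) (i : Fin 4) (H : Finset (ZMod L)) (a x : Site 4 L) (T : Finset (Site 4 L))
    (hT : T ⊆ (layerGraph i H).neighborFinset x ∩ ballSet hL i a) : (((univ \ ballSet hL i a).filter ((layerGraph i H).Adj x))).card + T.card ≤ 6 := by
  have hsub : ((univ \ ballSet hL i a).filter ((layerGraph i H).Adj x)) ⊆ (layerGraph i H).neighborFinset x \ T := by
    intro y hy
    rw [mem_filter, mem_sdiff] at hy
    rw [mem_sdiff, SimpleGraph.mem_neighborFinset]
    exact ⟨hy.2, fun hyT => hy.1.2 (mem_inter.1 (hT hyT)).2⟩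
  have h1 := card_le_card hsub
  rw [card_sdiff_of_subset (hT.trans inter_subset_left)] at h1
  have h2 := card_neighborFinset_layerGraph_le i H x
  have h3 : T.card ≤ ((layerGraph i H).neighborFinset x).card := card_le_card (hT.trans inter_subset_left)
  omega

/-- **An axis site has at most `5` layer-neighbours outside the ball** (its middle neighbour is inside). [folklore] -/
theorem card_exitSet_axis_le (hL : 6 ≤ L) {i : Fin 4} {H : Finset (ZMod L)} {a : Site 4 L} (ha : a i ∈ H) (k : Fin 3) (s : Bool) :
    (((univ \ ballSet hL i a).filter ((layerGraph i H).Adj (ballEmb i a (axis k s))))).card ≤ 5 := by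
  have h := card_exitSet_le hL i H a (ballEmb i a (axis k s)) {ballEmb i a (mid k s)} (by
    rw [singleton_subset_iff, mem_inter, SimpleGraph.mem_neighborFinset, layerGraph_adj_ballEmb_iff hL ha]
    exact ⟨by simp [b2Graph_adj, B2V.adj], ballEmb_mem_ballSet hL i a _⟩)
  rw [card_singleton] at h
  omega

/-- **A corner has at most `4` layer-neighbours outside the ball** (its two middle neighbours are inside). [folklore] -/
theorem card_exitSet_corner_le (hL : 6 ≤ L) {i : Fin 4} {H : Finset (ZMod L)} {a : Site 4 L} (ha : a i ∈ H) (k : Fin 3) (s s' : Bool) :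
    (((univ \ ballSet hL i a).filter ((layerGraph i H).Adj (ballEmb i a (corner k s s'))))).card ≤ 4 := by
  have hne : ballEmb i a (mid (k + 1) s) ≠ ballEmb i a (mid (k + 2) s') :=
    fun h => mid_succ_ne k s s' (ballEmb_injective hL i a h)
  have h := card_exitSet_le hL i H a (ballEmb i a (corner k s s')) {ballEmb i a (mid (k + 1) s), ballEmb i a (mid (k + 2) s')} (by
    intro y hy
    rw [mem_insert, mem_singleton] at hy
    rw [mem_inter, SimpleGraph.mem_neighborFinset]
    rcases hy with rfl | rfl
    · exact ⟨(layerGraph_adj_ballEmb_iff hL ha _ _).2 (by simp [b2Graph_adj, B2V.adj]), ballEmb_mem_ballSet hL i a _⟩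
    · exact ⟨(layerGraph_adj_ballEmb_iff hL ha _ _).2 (by simp [b2Graph_adj, B2V.adj]), ballEmb_mem_ballSet hL i a _⟩)
  rw [card_pair hne] at h
  omega

/-- **The centre and the middle sites have NO layer-neighbours outside the ball** (a unit step from them stays inside). [folklore] -/
theorem exitSet_eq_empty_of_inner (hL : 6 ≤ L) {i : Fin 4} {H : Finset (ZMod L)} {a : Site 4 L} (p : B2V)
    (hp : p = centre ∨ ∃ k' s', p = mid k' s') : ((univ \ ballSet hL i a).filter ((layerGraph i H).Adj (ballEmb i a p))) = ∅ := by
  refine eq_empty_of_forall_notMem fun y hy => ?_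
  rw [mem_filter, mem_sdiff] at hy
  obtain ⟨⟨-, hyS⟩, hadj⟩ := hy
  obtain ⟨v, hv, ε, hε, rfl⟩ := exists_single_of_adj hadj
  obtain ⟨k, rfl⟩ := Fin.exists_succAbove_eq hv
  obtain ⟨e, he, rfl⟩ := exists_int_cast_of_sign hε
  obtain ⟨⟨q₁, hq₁⟩, ⟨q₂, hq₂⟩⟩ := exists_of_inner_step p k hp
  apply hyS
  rcases he with rfl | rfl
  · have : ballEmb i a q₁ = ballEmb i a p + Pi.single (i.succAbove k) (((1 : ℤ) : ℤ) : ZMod L) := by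
      unfold ballEmb; rw [hq₁, map_add, offHom_single, add_assoc]
    rw [← this]; exact ballEmb_mem_ballSet hL i a _
  · have : ballEmb i a q₂ = ballEmb i a p + Pi.single (i.succAbove k) (((-1 : ℤ) : ℤ) : ZMod L) := by
      unfold ballEmb; rw [hq₂, map_add, offHom_single, add_assoc]
    rw [← this]; exact ballEmb_mem_ballSet hL i a _

/-! ### The rung-3 certificate of the balls and the two-point bound -/

/-- A sum over the ball sites, by type. [folklore] -/
theorem sum_B2V (g : B2V → ℝ) :
    ∑ p : B2V, g p = g centre + ∑ ks : Fin 3 × Bool, g (mid ks.1 ks.2) + ∑ ks : Fin 3 × Bool, g (axis ks.1 ks.2) +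
      ∑ c : Fin 3 × Bool × Bool, g (corner c.1 c.2.1 c.2.2) := by
  rw [← equivSum.symm.sum_comp]
  simp only [Fintype.sum_sum_type, Fintype.sum_unique, ← add_assoc]
  rfl

/-- **THE CERTIFICATE OF THE BALL `B₂(a)` FROM A BOUNDARY-SUM BOUND** (`L ≥ 6`, `a` at a selected height): if the boundary sum of `b2Graph` is
`≤ B` on `[0, β₁]`, then for `0 ≤ β ≤ β₁`: `φ_β(B₂(a)) = ∑_{x ∈ B₂(a)} ∑_{y ∉ B₂(a), y ∼ x} tanh β · ⟨σ_a σ_x⟩^∅_{B₂(a);β} ≤ tanh β₁ · B`.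
[cite: DuminilCopinTassionCMP2016, Lemma 2.7] -/
theorem ball_certificate_le_of (hL : 6 ≤ L) {β₁ B : ℝ}
    (hB : ∀ β : ℝ, 0 ≤ β → β ≤ β₁ →
      5 * ∑ ks : Fin 3 × Bool, isingTwoPoint b2Graph univ β 0 .free centre (axis ks.1 ks.2) +
        4 * ∑ c : Fin 3 × Bool × Bool, isingTwoPoint b2Graph univ β 0 .free centre (corner c.1 c.2.1 c.2.2) ≤ B)
    {β : ℝ} (h0 : 0 ≤ β) (hβ : β ≤ β₁) {i : Fin 4} (H : Finset (ZMod L)) {a : Site 4 L} (ha : a i ∈ H) :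
    ∑ x ∈ ballSet hL i a, ∑ _y ∈ (univ \ ballSet hL i a).filter ((layerGraph i H).Adj x),
        Real.tanh β * isingTwoPoint (layerGraph i H) (ballSet hL i a) β 0 .free a x ≤ Real.tanh β₁ * B := by
  have ht0 : 0 ≤ Real.tanh β := by simpa using Literature.Probability.LatticeModels.tanh_le_tanh h0
  have ht1 : Real.tanh β ≤ Real.tanh β₁ := Literature.Probability.LatticeModels.tanh_le_tanh hβ
  -- rewrite as a sum over `B2V` of (exit count) · tanh β · (two-point function of `b2Graph`)
  have hrw : ∑ x ∈ ballSet hL i a, ∑ _y ∈ (univ \ ballSet hL i a).filter ((layerGraph i H).Adj x),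
        Real.tanh β * isingTwoPoint (layerGraph i H) (ballSet hL i a) β 0 .free a x =
      ∑ p : B2V, ((((univ \ ballSet hL i a).filter ((layerGraph i H).Adj (ballEmb i a p)))).card : ℝ) * (Real.tanh β * isingTwoPoint b2Graph univ β 0 .free centre p) := by
    rw [ballSet, sum_map]
    refine sum_congr rfl fun p _ => ?_
    rw [sum_const, nsmul_eq_mul, ← isingTwoPoint_ballSet_eq hL ha β centre p, ballEmb_centre]
    rfl
  rw [hrw, sum_B2V]
  -- centre and middle terms vanish, axis terms carry `≤ 5`, corner terms `≤ 4`
  have hG0 : ∀ p, 0 ≤ Real.tanh β * isingTwoPoint b2Graph univ β 0 .free centre p := fun p =>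
    mul_nonneg ht0 (DCPLower.isingTwoPoint_free_nonneg_of_mem b2Graph h0 (mem_univ _) (mem_univ _))
  rw [exitSet_eq_empty_of_inner hL centre (Or.inl rfl)]
  simp only [card_empty, Nat.cast_zero, zero_mul, zero_add]
  have hmid : ∑ ks : Fin 3 × Bool, ((((univ \ ballSet hL i a).filter ((layerGraph i H).Adj (ballEmb i a (mid ks.1 ks.2))))).card : ℝ) *
      (Real.tanh β * isingTwoPoint b2Graph univ β 0 .free centre (mid ks.1 ks.2)) = 0 :=
    sum_eq_zero fun ks _ => by rw [exitSet_eq_empty_of_inner hL (mid ks.1 ks.2) (Or.inr ⟨ks.1, ks.2, rfl⟩)]; simp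
  have haxis : ∑ ks : Fin 3 × Bool, ((((univ \ ballSet hL i a).filter ((layerGraph i H).Adj (ballEmb i a (axis ks.1 ks.2))))).card : ℝ) *
      (Real.tanh β * isingTwoPoint b2Graph univ β 0 .free centre (axis ks.1 ks.2)) ≤
      ∑ ks : Fin 3 × Bool, 5 * (Real.tanh β * isingTwoPoint b2Graph univ β 0 .free centre (axis ks.1 ks.2)) :=
    sum_le_sum fun ks _ => mul_le_mul_of_nonneg_right (by exact_mod_cast card_exitSet_axis_le hL ha ks.1 ks.2) (hG0 _)
  have hcorner : ∑ c : Fin 3 × Bool × Bool, ((((univ \ ballSet hL i a).filter ((layerGraph i H).Adj (ballEmb i a (corner c.1 c.2.1 c.2.2))))).card : ℝ) *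
      (Real.tanh β * isingTwoPoint b2Graph univ β 0 .free centre (corner c.1 c.2.1 c.2.2)) ≤
      ∑ c : Fin 3 × Bool × Bool, 4 * (Real.tanh β * isingTwoPoint b2Graph univ β 0 .free centre (corner c.1 c.2.1 c.2.2)) :=
    sum_le_sum fun c _ => mul_le_mul_of_nonneg_right (by exact_mod_cast card_exitSet_corner_le hL ha c.1 c.2.1 c.2.2) (hG0 _)
  have hBβ := hB β h0 hβ
  have hB0 : 0 ≤ 5 * ∑ ks : Fin 3 × Bool, isingTwoPoint b2Graph univ β 0 .free centre (axis ks.1 ks.2) +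
      4 * ∑ c : Fin 3 × Bool × Bool, isingTwoPoint b2Graph univ β 0 .free centre (corner c.1 c.2.1 c.2.2) :=
    add_nonneg (mul_nonneg (by norm_num) (sum_nonneg fun _ _ => DCPLower.isingTwoPoint_free_nonneg_of_mem b2Graph h0 (mem_univ _) (mem_univ _)))
      (mul_nonneg (by norm_num) (sum_nonneg fun _ _ => DCPLower.isingTwoPoint_free_nonneg_of_mem b2Graph h0 (mem_univ _) (mem_univ _)))
  calc ∑ ks : Fin 3 × Bool, ((((univ \ ballSet hL i a).filter ((layerGraph i H).Adj (ballEmb i a (mid ks.1 ks.2))))).card : ℝ) *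
          (Real.tanh β * isingTwoPoint b2Graph univ β 0 .free centre (mid ks.1 ks.2)) +
        ∑ ks : Fin 3 × Bool, ((((univ \ ballSet hL i a).filter ((layerGraph i H).Adj (ballEmb i a (axis ks.1 ks.2))))).card : ℝ) *
          (Real.tanh β * isingTwoPoint b2Graph univ β 0 .free centre (axis ks.1 ks.2)) +
        ∑ c : Fin 3 × Bool × Bool, ((((univ \ ballSet hL i a).filter ((layerGraph i H).Adj (ballEmb i a (corner c.1 c.2.1 c.2.2))))).card : ℝ) *
          (Real.tanh β * isingTwoPoint b2Graph univ β 0 .free centre (corner c.1 c.2.1 c.2.2))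
      ≤ 0 + ∑ ks : Fin 3 × Bool, 5 * (Real.tanh β * isingTwoPoint b2Graph univ β 0 .free centre (axis ks.1 ks.2)) +
        ∑ c : Fin 3 × Bool × Bool, 4 * (Real.tanh β * isingTwoPoint b2Graph univ β 0 .free centre (corner c.1 c.2.1 c.2.2)) := by
        rw [hmid]; gcongr
    _ = Real.tanh β * (5 * ∑ ks : Fin 3 × Bool, isingTwoPoint b2Graph univ β 0 .free centre (axis ks.1 ks.2) +
        4 * ∑ c : Fin 3 × Bool × Bool, isingTwoPoint b2Graph univ β 0 .free centre (corner c.1 c.2.1 c.2.2)) := by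
        rw [mul_sum, mul_sum, mul_add, mul_sum, mul_sum, zero_add]
        congr 1 <;> refine sum_congr rfl fun _ _ => ?_ <;> ring
    _ ≤ Real.tanh β₁ * B := mul_le_mul ht1 hBβ hB0 (ht0.trans ht1)

/-- **TWO-POINT BOUND OF THE LAYER ISING MODEL FROM A BOUNDARY-SUM BOUND** (`L ≥ 6`): if the boundary sum of `b2Graph` is `≤ B` on `[0, β₁]`, then for
every selected set `H`, `0 ≤ β ≤ β₁` and all sites `b, t`: `⟨σ_b σ_t⟩^∅_{univ;β} ≤ (tanh β₁ · B)^{⌊dist_j(t,b)/3⌋}` on `layerGraph i H` (Simon–Lieb with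
the balls `B₂`, radius `2`; unselected heights are isolated sites with certificate `0`). [cite: DuminilCopinTassionCMP2016, Lemma 2.7] -/
theorem isingTwoPoint_layer_le_pow_of (hL : 6 ≤ L) {β₁ B : ℝ}
    (hB : ∀ β : ℝ, 0 ≤ β → β ≤ β₁ →
      5 * ∑ ks : Fin 3 × Bool, isingTwoPoint b2Graph univ β 0 .free centre (axis ks.1 ks.2) +
        4 * ∑ c : Fin 3 × Bool × Bool, isingTwoPoint b2Graph univ β 0 .free centre (corner c.1 c.2.1 c.2.2) ≤ B)
    {β : ℝ} (h0 : 0 ≤ β) (hβ : β ≤ β₁) (i j : Fin 4) (H : Finset (ZMod L)) (t b : Site 4 L) :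
    isingTwoPoint (layerGraph i H) univ β 0 .free b t ≤ (Real.tanh β₁ * B) ^ (jDist j t b / 3) := by
  classical
  -- `0 ≤ tanh β₁ · B` (from the boundary sum at `β`, which is nonnegative by GKS I)
  have hφ0 : 0 ≤ Real.tanh β₁ * B := by
    have ht1 : 0 ≤ Real.tanh β₁ := by simpa using Literature.Probability.LatticeModels.tanh_le_tanh (h0.trans hβ)
    refine mul_nonneg ht1 ((add_nonneg (mul_nonneg (by norm_num) (sum_nonneg fun _ _ => ?_))
      (mul_nonneg (by norm_num) (sum_nonneg fun _ _ => ?_))).trans (hB β h0 hβ))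
    · exact DCPLower.isingTwoPoint_free_nonneg_of_mem b2Graph h0 (mem_univ _) (mem_univ _)
    · exact DCPLower.isingTwoPoint_free_nonneg_of_mem b2Graph h0 (mem_univ _) (mem_univ _)
  refine IsingStar.isingTwoPoint_free_le_pow_of_certificate (layerGraph i H) h0
    (S := fun a => if a i ∈ H then ballSet hL i a else {a}) 2 (fun a _ => subset_univ _) (fun a _ => ?_) (jDist j t)
    (fun a _ x hx => ?_) (fun y y' h => jDist_le_of_adj j t h) (jDist_self j t) (mem_univ t) (fun a _ => ?_)
    (jDist j t b / 3) b (mem_univ b) (by omega)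
  · -- `a ∈ S a`
    by_cases ha : a i ∈ H
    · simp only [ha, if_true]; exact mem_ballSet_self hL i a
    · simp only [ha, if_false]; exact mem_singleton_self a
  · -- radius `2`
    by_cases ha : a i ∈ H
    · simp only [ha, if_true, ballSet, mem_map] at hx
      obtain ⟨p, -, rfl⟩ := hx
      exact jDist_ballEmb_le j t i a p
    · simp only [ha, if_false, mem_singleton] at hx
      subst hx; omega
  · -- the certificate
    by_cases ha : a i ∈ H
    · simp only [ha, if_true]
      exact ball_certificate_le_of hL hB h0 hβ H ha
    · simp only [ha, if_false, sum_singleton]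
      have hempty : (univ \ {a}).filter ((layerGraph i H).Adj a) = ∅ :=
        eq_empty_of_forall_notMem fun y hy => ha (height_mem_of_adj (mem_filter.1 hy).2)
      rw [hempty, sum_empty]
      exact hφ0

/-- **RUNG 3 AT `β₀ = artanh(4/21)`**: `⟨σ_b σ_t⟩^∅_{univ;β} ≤ φ₀^{⌊dist_j(t,b)/3⌋}`, `φ₀ = b2Rate = 0.978680…`, for `L ≥ 6`, every `H`, `0 ≤ β ≤ β₀`.
[cite: DuminilCopinTassionCMP2016, Lemma 2.7] -/
theorem isingTwoPoint_layer_le_b2Rate_pow (hL : 6 ≤ L) {β : ℝ} (h0 : 0 ≤ β) (hβ : β ≤ b2Beta) (i j : Fin 4) (H : Finset (ZMod L))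
    (t b : Site 4 L) : isingTwoPoint (layerGraph i H) univ β 0 .free b t ≤ b2Rate ^ (jDist j t b / 3) := by
  have h := isingTwoPoint_layer_le_pow_of hL (fun β h0 hβ => b2_boundarySum_le h0 hβ) h0 hβ i j H t b
  rwa [tanh_b2Beta] at h

/-- **RUNG 3 AT THE SHARP COUPLING `β₁ = artanh(23/120)`**: `⟨σ_b σ_t⟩^∅_{univ;β} ≤ φ₁^{⌊dist_j(t,b)/3⌋}`, `φ₁ = b2RateS = 0.998581…`, for `L ≥ 6`,
every `H`, `0 ≤ β ≤ β₁`. [cite: DuminilCopinTassionCMP2016, Lemma 2.7] -/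
theorem isingTwoPoint_layer_le_b2RateS_pow (hL : 6 ≤ L) {β : ℝ} (h0 : 0 ≤ β) (hβ : β ≤ b2BetaS) (i j : Fin 4) (H : Finset (ZMod L))
    (t b : Site 4 L) : isingTwoPoint (layerGraph i H) univ β 0 .free b t ≤ b2RateS ^ (jDist j t b / 3) := by
  have h := isingTwoPoint_layer_le_pow_of hL (fun β h0 hβ => b2_boundarySum_le_sharp h0 hβ) h0 hβ i j H t b
  rwa [tanh_b2BetaS] at h

end ZTwo

end Summit.Ventures.YMGap.RobustBall

end
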